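import Mathlib.RingTheory.Regular.RegularSequence
import Mathlib.RingTheory.KrullDimension.Regular
import Mathlib.RingTheory.RegularLocalRing.Defs
import Mathlib.Algebra.CharP.Quotient
import Mathlib.RingTheory.Ideal.Quotient.Operations
import Literature.AlgebraicGeometry.Resolution.CohenMacaulayCatenary
import Literature.RingTheory.TightClosure.TightClosure
import Summits.ResolutionOfSingularities.ResolutionOfSingularities.Theorems.FrobeniusLadderFInjectiveMacaulayficationDeformation
import Summits.ResolutionOfSingularities.ResolutionOfSingularities.Theorems.FrobeniusLadderFInjectiveMacaulayficationExtendSop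
import Summits.ResolutionOfSingularities.ResolutionOfSingularities.Theorems.FrobeniusLadderFInjectiveMacaulayficationDegreeZeroDescentLocal
import Mathlib.RingTheory.Localization.Away.Basic
import HarnessLib

/-!
# Iterated deformation and the complete-intersection chart core (`ciChartCore`)

Support file for crux stmt-ResolutionOfSingularities-15315 (`FrobeniusLadder.FInjectiveMacaulayfication`),
chain w45a, seat res-L1-w45a-stub-6 (res-D-pv-018, D→L convert). [OURS · L1 W4.5a] — NOT a statement of the
manuscript [claim: Hironaka2017]; AI-written, weaker than expert review.

The CI-CN engine (idea-1 card 4 `f-torific-key-reembedding`, `Sketch-L1-idea-1.lean` §8; CRUX-PLAN v7 §2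
«CI-CN_{κ=1}») certifies the crux's per-stalk clause (every system of parameters weakly regular and
generating a Frobenius closed ideal — Cohen–Macaulay + F-injective, inline form) at a chart point of a toric
model of a COMPLETE INTERSECTION from the clause for the «initial complete intersection» on the orbit. In
the chart's regular local ring `S` the local equations `gs` and the orbit coordinates `ys` together have the
expected codimension, so `ys` is a regular sequence on `S ⧸ (gs)` and Fedder's deformation theorem
(`Deformation.cmfi_of_cmfi_quotient`, p132502) can be iterated along it.

* §1 `exists_isWeaklyRegular_append`, `isWeaklyRegular_of_ringKrullDim_quotient`,
  `sop_isWeaklyRegular_quotient_ofList` — in a regular local ring `S`, a list `L ⊆ 𝔪` with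
  `dim S = |L| + dim S⧸(L)` is a weakly regular sequence (extend it to a system of parameters by
  `ExtendSop.stub_extendSop`; regular ⇒ Cohen–Macaulay, `exists_isRegular_length_eq_ringKrullDim` +
  `SopWeaklyRegular.stub_sopWeaklyRegular`), and every system of parameters of `S ⧸ (L)` is weakly regular
  (the Cohen–Macaulay half of Fedder's criterion for complete intersections).
* §2 `iteratedDeformation` — the clause descends along a weakly regular sequence `ys ⊆ 𝔪` of a Noetherian
  local ring of characteristic `p`: `clause (R ⧸ (ys)) ⇒ clause R` (induction on `ys` over
  `cmfi_of_cmfi_quotient`, `(R⧸y) ⧸ (ys) ≅ R ⧸ (y :: ys)` by `DoubleQuot.quotQuotEquivQuotSup`, transport by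
  `DegreeZeroDescent.inlineClause_of_ringEquiv`).
* §3 `ciChartCore` (idea-1 §8, signature verbatim with `InlineClause` unfolded) and `ciChartCore'`
  (`[IsRegularLocalRing S]` form): `S` regular local of characteristic `p`, `gs`, `ys ⊆ 𝔪_S` with
  `dim S⧸(gs ++ ys) + |gs| + |ys| = dim S`; if `S ⧸ (gs ++ ys)` satisfies the clause then so does `S ⧸ (gs)`;
  `isDomain_of_away` (idea-1 §8, verbatim): the integrality half at a chart point — `B ↪ B[1/y]` for a
  non-zero-divisor `y`, so `B` is a domain if `B[1/y]` is.

No definitions, no named facts, no `sorry`; glue on Mathlib + tree lemmas. [folklore]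
-/

-- single-problem summit: the doubled namespace component is forced
set_option linter.dupNamespace false

namespace Summit.ResolutionOfSingularities.ResolutionOfSingularities.Theorems.FInjectiveMacaulayfication.CIChartCore

open IsLocalRing RingTheory.Sequence Literature.RingTheory.TightClosure
  Literature.AlgebraicGeometry.Resolution
  Summit.ResolutionOfSingularities.ResolutionOfSingularities.Theorems.FInjectiveMacaulayfication
open scoped Pointwise

/-! ## §0 Small bookkeeping -/

/-- A quotient of a ring of prime characteristic `p` by a proper ideal has characteristic `p`. [folklore] -/
-- adapted from `FRationalResolution.charP_quotient_of_ne_top` (same summit, heavier imports)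
theorem charP_quotient_of_ne_top (p : ℕ) [Fact p.Prime] {S : Type*} [CommRing S] [CharP S p]
    (Q : Ideal S) (hQ : Q ≠ ⊤) : CharP (S ⧸ Q) p := by
  refine CharP.quotient' p Q fun x hx => ?_
  by_contra hne
  have hndvd : ¬ p ∣ x := fun h => hne ((CharP.cast_eq_zero_iff S p x).mpr h)
  have hcop : x.Coprime p := ((Nat.Prime.coprime_iff_not_dvd Fact.out).mpr hndvd).symm
  have hu : IsUnit ((x : ZMod p) : ZMod p) := (ZMod.unitOfCoprime x hcop).isUnit
  have hu' : IsUnit ((x : S)) := by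
    have := hu.map (ZMod.castHom (dvd_refl p) S)
    simpa only [map_natCast] using this
  exact hQ (Ideal.eq_top_of_isUnit_mem Q hx hu')

/-- `Ideal.ofList L = Ideal.span (Set.range L.get)`. [folklore] -/
theorem ofList_eq_span_range_get {S : Type*} [CommRing S] (L : List S) :
    Ideal.ofList L = Ideal.span (Set.range L.get) := by
  rw [Set.range_list_get]

/-- The submodule `(L) • ⊤` of `S` is the ideal `(L)`. [folklore] -/
theorem ofList_smul_top {S : Type*} [CommRing S] (L : List S) :
    (Ideal.ofList L • ⊤ : Submodule S S) = Ideal.ofList L := by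
  rw [smul_eq_mul, Ideal.mul_top]

/-- A list of elements of the maximal ideal generates a proper ideal, so the quotient is a local ring
and the quotient map sends `𝔪` onto the maximal ideal of the quotient. [folklore] -/
theorem isLocalRing_quotient_ofList {S : Type*} [CommRing S] [IsLocalRing S] (L : List S)
    (hL : ∀ x ∈ L, x ∈ maximalIdeal S) :
    Ideal.ofList L ≠ ⊤ ∧ Nontrivial (S ⧸ Ideal.ofList L) ∧ IsLocalRing (S ⧸ Ideal.ofList L) := by
  have hle : Ideal.ofList L ≤ maximalIdeal S := Ideal.span_le.mpr fun x hx => hL x hx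
  have hne : Ideal.ofList L ≠ ⊤ := fun h => (maximalIdeal.isMaximal S).ne_top (top_le_iff.mp (h ▸ hle))
  haveI : Nontrivial (S ⧸ Ideal.ofList L) := Ideal.Quotient.nontrivial_iff.mpr hne
  exact ⟨hne, ‹_›, IsLocalRing.of_surjective' (Ideal.Quotient.mk _) Ideal.Quotient.mk_surjective⟩

/-- Weak regularity of a list on the quotient RING `S ⧸ I` (as a module over itself, list mapped) from
weak regularity on the quotient MODULE `S ⧸ I • ⊤` (over `S`). [folklore] -/
theorem isWeaklyRegular_quotient_of_quotient_smul_top {S : Type*} [CommRing S] (I : Ideal S)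
    (L : List S) (h : IsWeaklyRegular (S ⧸ (I • ⊤ : Submodule S S)) L) :
    IsWeaklyRegular (S ⧸ I) (L.map (Ideal.Quotient.mk I)) := by
  have heq : (I • ⊤ : Submodule S S) = I := by rw [smul_eq_mul, Ideal.mul_top]
  let e : (S ⧸ (I • ⊤ : Submodule S S)) ≃ₗ[S] S ⧸ I := Submodule.quotEquivOfEq _ _ heq
  have h1 : IsWeaklyRegular (S ⧸ I) L := (e.isWeaklyRegular_congr L).mp h
  have h2 := (isWeaklyRegular_map_algebraMap_iff (S ⧸ I) (S ⧸ I) L).mpr h1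
  rwa [Ideal.Quotient.algebraMap_eq] at h2

/-! ## §1 Regular sequences of the expected codimension in a regular local ring -/

section Regular

variable {S : Type} [CommRing S] [IsRegularLocalRing S]

/-- **Extension to a weakly regular system of parameters.** In a regular local ring `S`, a list
`L ⊆ 𝔪` with `dim S = |L| + e` and `dim S⧸(L) = e` extends by `e` further elements of `𝔪` to a system of
parameters, and the extended list is a weakly regular sequence (regular ⇒ Cohen–Macaulay ⇒ every system
of parameters is weakly regular). [folklore] -/
theorem exists_isWeaklyRegular_append (L : List S) (hL : ∀ x ∈ L, x ∈ maximalIdeal S) (e : ℕ)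
    (hdim : ringKrullDim S = ((L.length + e : ℕ) : WithBot ℕ∞))
    (hquot : ringKrullDim (S ⧸ Ideal.ofList L) = (e : WithBot ℕ∞)) :
    ∃ t : Fin e → S, (∀ i, t i ∈ maximalIdeal S) ∧ IsWeaklyRegular S (L ++ List.ofFn t) := by
  have _ := hL
  -- extend `L` (as a `Fin`-family) to a system of parameters
  have hquot' : ringKrullDim (S ⧸ Ideal.span (Set.range L.get)) = (e : WithBot ℕ∞) := by
    rw [← ofList_eq_span_range_get]; exact hquot
  obtain ⟨t, ht⟩ := ExtendSop.stub_extendSop S L.length e L.get hdim hquot'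
  refine ⟨t, fun i => ?_, ?_⟩
  · -- `t i ∈ rad (L, t) = 𝔪`
    rw [← ht.2]
    exact Ideal.le_radical (Ideal.subset_span ⟨Fin.natAdd L.length i, by simp [Fin.append_right]⟩)
  · -- regular ⇒ Cohen–Macaulay ⇒ the system of parameters `(L, t)` is weakly regular
    obtain ⟨rs, hrs, hmem, hlen⟩ := exists_isRegular_length_eq_ringKrullDim S
    have hw := FRationalModification.SopWeaklyRegular.stub_sopWeaklyRegular ⟨rs, hrs, hmem, hlen⟩
      (Fin.append L.get t) ht
    rwa [List.ofFn_fin_append, List.ofFn_get] at hw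

/-- **A list of the expected codimension is weakly regular**: in a regular local ring `S`, a list
`L ⊆ 𝔪` with `dim S = |L| + dim S⧸(L)` is a weakly regular sequence. [folklore] -/
theorem isWeaklyRegular_of_ringKrullDim_quotient (L : List S) (hL : ∀ x ∈ L, x ∈ maximalIdeal S)
    (e : ℕ) (hdim : ringKrullDim S = ((L.length + e : ℕ) : WithBot ℕ∞))
    (hquot : ringKrullDim (S ⧸ Ideal.ofList L) = (e : WithBot ℕ∞)) : IsWeaklyRegular S L := by
  obtain ⟨t, -, hw⟩ := exists_isWeaklyRegular_append L hL e hdim hquot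
  exact ((isWeaklyRegular_append_iff S L (List.ofFn t)).mp hw).1

/-- **The quotient by a list of the expected codimension is Cohen–Macaulay** (regular ambient): every
system of parameters of `S ⧸ (L)` is a weakly regular sequence. Proof: the extension `t` of `L` to a system
of parameters of `S` maps to a regular sequence of length `dim S⧸(L)` in the maximal ideal of `S ⧸ (L)`,
and a local ring with such a sequence has all systems of parameters weakly regular
(`SopWeaklyRegular.stub_sopWeaklyRegular`, Matsumura 17.4). [folklore] -/
theorem sop_isWeaklyRegular_quotient_ofList (L : List S) (hL : ∀ x ∈ L, x ∈ maximalIdeal S)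
    (e : ℕ) (hdim : ringKrullDim S = ((L.length + e : ℕ) : WithBot ℕ∞))
    (hquot : ringKrullDim (S ⧸ Ideal.ofList L) = (e : WithBot ℕ∞)) :
    ∀ d : ℕ, ringKrullDim (S ⧸ Ideal.ofList L) = d → ∀ s : Fin d → S ⧸ Ideal.ofList L,
      (Ideal.span (Set.range s)).radical.IsMaximal →
      IsWeaklyRegular (S ⧸ Ideal.ofList L) (List.ofFn s) := by
  intro d hd s hs
  obtain ⟨-, hnt, hloc⟩ := isLocalRing_quotient_ofList L hL
  set mk := Ideal.Quotient.mk (Ideal.ofList L)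
  obtain ⟨t, htm, hw⟩ := exists_isWeaklyRegular_append L hL e hdim hquot
  -- the tail `t` is weakly regular on `S ⧸ (L)`, hence regular (its members are in the maximal ideal)
  have hw₂ : IsWeaklyRegular (S ⧸ Ideal.ofList L) ((List.ofFn t).map mk) :=
    isWeaklyRegular_quotient_of_quotient_smul_top _ _
      ((isWeaklyRegular_append_iff S L (List.ofFn t)).mp hw).2
  have hmaxq : (maximalIdeal S).map mk = maximalIdeal (S ⧸ Ideal.ofList L) :=
    map_maximalIdeal_of_surjective mk Ideal.Quotient.mk_surjective
  have hmem₂ : ∀ r ∈ (List.ofFn t).map mk, r ∈ maximalIdeal (S ⧸ Ideal.ofList L) := by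
    intro r hr
    obtain ⟨x, hx, rfl⟩ := List.mem_map.mp hr
    obtain ⟨i, rfl⟩ := List.mem_ofFn.mp hx
    rw [← hmaxq]
    exact Ideal.mem_map_of_mem mk (htm i)
  have hreg₂ : IsRegular (S ⧸ Ideal.ofList L) ((List.ofFn t).map mk) :=
    IsRegular.of_isWeaklyRegular_of_mem_maximalIdeal (S ⧸ Ideal.ofList L) hmem₂ hw₂
  have hlen₂ : (((List.ofFn t).map mk).length : WithBot ℕ∞) = ringKrullDim (S ⧸ Ideal.ofList L) := by
    rw [List.length_map, List.length_ofFn, hquot]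
  exact FRationalModification.SopWeaklyRegular.stub_sopWeaklyRegular ⟨_, hreg₂, hmem₂, hlen₂⟩ s
    (isSystemOfParameters_iff.mpr ⟨hd, hs⟩)

end Regular

/-! ## §2 Iterated deformation: the clause descends along a weakly regular sequence -/

/-- Auxiliary form of `iteratedDeformation`, by induction on the length of the sequence. -/
theorem iteratedDeformation_aux (p : ℕ) [Fact p.Prime] : ∀ (n : ℕ) (R : Type) [CommRing R]
    [IsNoetherianRing R] [IsLocalRing R] [CharP R p] (ys : List R), ys.length = n →
    (∀ y ∈ ys, y ∈ maximalIdeal R) → IsWeaklyRegular R ys →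
    (∀ d : ℕ, ringKrullDim (R ⧸ Ideal.ofList ys) = d → ∀ s : Fin d → R ⧸ Ideal.ofList ys,
      (Ideal.span (Set.range s)).radical.IsMaximal →
      IsWeaklyRegular (R ⧸ Ideal.ofList ys) (List.ofFn s) ∧
      ∀ y : R ⧸ Ideal.ofList ys, (∃ e : ℕ, y ^ p ^ e ∈
        Ideal.span ((fun z : R ⧸ Ideal.ofList ys => z ^ p ^ e) ''
          (Ideal.span (Set.range s) : Set (R ⧸ Ideal.ofList ys)))) → y ∈ Ideal.span (Set.range s)) →
    ∀ d : ℕ, ringKrullDim R = d → ∀ s : Fin d → R, (Ideal.span (Set.range s)).radical.IsMaximal →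
      IsWeaklyRegular R (List.ofFn s) ∧
      ∀ y : R, (∃ e : ℕ, y ^ p ^ e ∈ Ideal.span ((fun z : R => z ^ p ^ e) ''
        (Ideal.span (Set.range s) : Set R))) → y ∈ Ideal.span (Set.range s) := by
  intro n
  induction n with
  | zero =>
    intro R _ _ _ _ ys hlen _ _ hcl
    obtain rfl : ys = [] := List.eq_nil_of_length_eq_zero hlen
    -- `R ⧸ ([]) = R ⧸ ⊥ ≅ R`
    let e : (R ⧸ Ideal.ofList ([] : List R)) ≃+* R :=
      (Ideal.quotEquivOfEq (Ideal.ofList_nil (R := R))).trans (RingEquiv.quotientBot R)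
    exact DegreeZeroDescent.inlineClause_of_ringEquiv p e hcl
  | succ n ih =>
    intro R _ _ _ _ ys hlen hmem hw hcl
    obtain ⟨y, ys, rfl⟩ : ∃ y ys', ys = y :: ys' := by
      cases ys with
      | nil => exact absurd hlen (by simp)
      | cons y ys' => exact ⟨y, ys', rfl⟩
    have hym : y ∈ maximalIdeal R := hmem y (List.mem_cons_self ..)
    have hysm : ∀ z ∈ ys, z ∈ maximalIdeal R := fun z hz => hmem z (List.mem_cons_of_mem y hz)
    have hlen' : ys.length = n := by simpa using hlen
    -- `y` is a non-zero-divisor and `ys` is weakly regular on `R ⧸ (y)`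
    obtain ⟨hyreg, hw'⟩ := (isWeaklyRegular_cons_iff R y ys).mp hw
    have hy0 : y ∈ nonZeroDivisors R :=
      isRegular_iff_mem_nonZeroDivisors.mp (isLeftRegular_iff_isRegular.mp (isLeftRegular_iff.mpr hyreg))
    -- the local ring `R' = R ⧸ (y)`
    obtain ⟨hnt, hloc⟩ := isLocalRing_quotient_span_singleton hym
    set R' := R ⧸ Ideal.span {y}
    set mk := Ideal.Quotient.mk (Ideal.span {y})
    have hne : Ideal.span {y} ≠ ⊤ := fun h =>
      (maximalIdeal.isMaximal R).ne_top (top_le_iff.mp (h ▸ (Ideal.span_singleton_le_iff_mem _).mpr hym))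
    haveI : CharP R' p := charP_quotient_of_ne_top p _ hne
    -- `ys` (mapped) is weakly regular on `R'` and lies in its maximal ideal
    have heq : (y • (⊤ : Submodule R R)) = Ideal.span {y} := by
      rw [← Submodule.ideal_span_singleton_smul, smul_eq_mul, Ideal.mul_top]
    let e₁ : QuotSMulTop y R ≃ₗ[R] R' := Submodule.quotEquivOfEq _ _ heq
    have hw₁ : IsWeaklyRegular R' ys := (e₁.isWeaklyRegular_congr ys).mp hw'
    have hw₂ : IsWeaklyRegular R' (ys.map mk) := by
      have h := (isWeaklyRegular_map_algebraMap_iff R' R' ys).mpr hw₁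
      rwa [Ideal.Quotient.algebraMap_eq] at h
    have hmaxq : (maximalIdeal R).map mk = maximalIdeal R' :=
      map_maximalIdeal_of_surjective mk Ideal.Quotient.mk_surjective
    have hmem₂ : ∀ z ∈ ys.map mk, z ∈ maximalIdeal R' := by
      intro z hz
      obtain ⟨x, hx, rfl⟩ := List.mem_map.mp hz
      rw [← hmaxq]
      exact Ideal.mem_map_of_mem mk (hysm x hx)
    have hlen₂ : (ys.map mk).length = n := by rw [List.length_map, hlen']
    -- `R' ⧸ (ys) ≅ R ⧸ (y :: ys)`, so the clause holds for `R' ⧸ (ys)`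
    have e₂ : (R' ⧸ Ideal.ofList (ys.map mk)) ≃+* R ⧸ Ideal.ofList (y :: ys) :=
      ((Ideal.quotEquivOfEq (Ideal.map_ofList mk ys).symm).trans
        (DoubleQuot.quotQuotEquivQuotSup (Ideal.span {y}) (Ideal.ofList ys))).trans
        (Ideal.quotEquivOfEq (Ideal.ofList_cons y ys).symm)
    have hcl' := DegreeZeroDescent.inlineClause_of_ringEquiv p e₂.symm hcl
    -- induction hypothesis: the clause holds for `R'`; deformation: it holds for `R`
    have hR' := ih R' (ys.map mk) hlen₂ hmem₂ hw₂ hcl'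
    exact Deformation.cmfi_of_cmfi_quotient p R y hym hy0 hR'

/-- **ITERATED DEFORMATION** (idea-1 `Sketch-L1-idea-1.lean` §8 `iteratedDeformation`, `InlineClause`
unfolded). Let `(R, 𝔪)` be a Noetherian local ring of prime characteristic `p` and `ys ⊆ 𝔪` a weakly
regular sequence. If `R ⧸ (ys)` satisfies the per-stalk clause of crux `FInjectiveMacaulayfication` (every
system of parameters weakly regular with Frobenius closed ideal, inline form), then so does `R`. Induction
on `ys` over Fedder's deformation theorem `Deformation.cmfi_of_cmfi_quotient` (Fedder 1983, Thm. 3.4 (1)),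
with `(R ⧸ y) ⧸ (ys) ≅ R ⧸ (y :: ys)`. [cite: Fedder1983, Thm. 3.4 (1)] -/
theorem iteratedDeformation : ∀ (p : ℕ) [Fact p.Prime] (R : Type) [CommRing R] [IsNoetherianRing R]
    [IsLocalRing R] [CharP R p] (ys : List R), (∀ y ∈ ys, y ∈ IsLocalRing.maximalIdeal R) →
    RingTheory.Sequence.IsWeaklyRegular R ys →
    (∀ d : ℕ, ringKrullDim (R ⧸ Ideal.ofList ys) = d → ∀ s : Fin d → R ⧸ Ideal.ofList ys,
      (Ideal.span (Set.range s)).radical.IsMaximal →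
      RingTheory.Sequence.IsWeaklyRegular (R ⧸ Ideal.ofList ys) (List.ofFn s) ∧
      ∀ y : R ⧸ Ideal.ofList ys, (∃ e : ℕ, y ^ p ^ e ∈
        Ideal.span ((fun z : R ⧸ Ideal.ofList ys => z ^ p ^ e) ''
          (Ideal.span (Set.range s) : Set (R ⧸ Ideal.ofList ys)))) → y ∈ Ideal.span (Set.range s)) →
    ∀ d : ℕ, ringKrullDim R = d → ∀ s : Fin d → R, (Ideal.span (Set.range s)).radical.IsMaximal →
      RingTheory.Sequence.IsWeaklyRegular R (List.ofFn s) ∧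
      ∀ y : R, (∃ e : ℕ, y ^ p ^ e ∈ Ideal.span ((fun z : R => z ^ p ^ e) ''
        (Ideal.span (Set.range s) : Set R))) → y ∈ Ideal.span (Set.range s) := by
  intro p _ R _ _ _ _ ys hmem hw hcl
  exact iteratedDeformation_aux p ys.length R ys rfl hmem hw hcl

/-! ## §3 The complete-intersection chart core -/

/-- **CI CHART CORE, `IsRegularLocalRing` form.** Let `S` be a regular local ring of prime characteristic
`p`, `gs` (local equations) and `ys` (orbit coordinates) lists of elements of `𝔪_S` such that the «initial
complete intersection» `S ⧸ (gs ++ ys)` has the expected dimension `dim S − |gs| − |ys|`. If `S ⧸ (gs ++ ys)`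
satisfies the per-stalk clause of crux `FInjectiveMacaulayfication` (inline form), then so does
`S ⧸ (gs)`. Proof: `gs ++ ys` is weakly regular on `S` (§1), so `ys` is weakly regular on `S ⧸ (gs)`
(`isWeaklyRegular_append_iff`), and `iteratedDeformation` applies in the Noetherian local ring `S ⧸ (gs)`
with `(S ⧸ gs) ⧸ (ys) ≅ S ⧸ (gs ++ ys)`. [folklore] -/
theorem ciChartCore' (p : ℕ) [Fact p.Prime] (S : Type) [CommRing S] [IsRegularLocalRing S] [CharP S p]
    (gs ys : List S) (hgs : ∀ g ∈ gs, g ∈ maximalIdeal S) (hys : ∀ y ∈ ys, y ∈ maximalIdeal S)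
    (hdim : ringKrullDim (S ⧸ Ideal.ofList (gs ++ ys)) + ((gs.length + ys.length : ℕ) : WithBot ℕ∞) =
      ringKrullDim S)
    (hcl : ∀ d : ℕ, ringKrullDim (S ⧸ Ideal.ofList (gs ++ ys)) = d →
      ∀ s : Fin d → S ⧸ Ideal.ofList (gs ++ ys), (Ideal.span (Set.range s)).radical.IsMaximal →
      IsWeaklyRegular (S ⧸ Ideal.ofList (gs ++ ys)) (List.ofFn s) ∧
      ∀ y : S ⧸ Ideal.ofList (gs ++ ys), (∃ e : ℕ, y ^ p ^ e ∈
        Ideal.span ((fun z : S ⧸ Ideal.ofList (gs ++ ys) => z ^ p ^ e) ''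
          (Ideal.span (Set.range s) : Set (S ⧸ Ideal.ofList (gs ++ ys))))) → y ∈ Ideal.span (Set.range s)) :
    ∀ d : ℕ, ringKrullDim (S ⧸ Ideal.ofList gs) = d → ∀ s : Fin d → S ⧸ Ideal.ofList gs,
      (Ideal.span (Set.range s)).radical.IsMaximal →
      IsWeaklyRegular (S ⧸ Ideal.ofList gs) (List.ofFn s) ∧
      ∀ y : S ⧸ Ideal.ofList gs, (∃ e : ℕ, y ^ p ^ e ∈
        Ideal.span ((fun z : S ⧸ Ideal.ofList gs => z ^ p ^ e) ''
          (Ideal.span (Set.range s) : Set (S ⧸ Ideal.ofList gs)))) → y ∈ Ideal.span (Set.range s) := by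
  set L := gs ++ ys with hL_def
  have hL : ∀ x ∈ L, x ∈ maximalIdeal S := by
    intro x hx
    rcases List.mem_append.mp hx with hx | hx
    · exact hgs x hx
    · exact hys x hx
  -- dimension bookkeeping: `dim S⧸(L) = e`, `dim S = |L| + e`
  obtain ⟨-, hntL, hlocL⟩ := isLocalRing_quotient_ofList L hL
  obtain ⟨e, he⟩ := exists_nat_cast_eq_ringKrullDim (R := S ⧸ Ideal.ofList L)
  have hdimS : ringKrullDim S = ((L.length + e : ℕ) : WithBot ℕ∞) := by
    rw [← hdim, he, hL_def, List.length_append]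
    push_cast
    ring
  -- `gs ++ ys` is weakly regular on `S`; hence `ys` is weakly regular on `S ⧸ (gs)`
  have hw : IsWeaklyRegular S L := isWeaklyRegular_of_ringKrullDim_quotient L hL e hdimS he
  obtain ⟨-, hntg, hlocg⟩ := isLocalRing_quotient_ofList gs hgs
  set S' := S ⧸ Ideal.ofList gs
  set mk := Ideal.Quotient.mk (Ideal.ofList gs)
  have hw₂ : IsWeaklyRegular S' (ys.map mk) :=
    isWeaklyRegular_quotient_of_quotient_smul_top _ _ ((isWeaklyRegular_append_iff S gs ys).mp hw).2
  have hne : Ideal.ofList gs ≠ ⊤ := (isLocalRing_quotient_ofList gs hgs).1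
  haveI : CharP S' p := charP_quotient_of_ne_top p _ hne
  have hmaxq : (maximalIdeal S).map mk = maximalIdeal S' :=
    map_maximalIdeal_of_surjective mk Ideal.Quotient.mk_surjective
  have hmem₂ : ∀ z ∈ ys.map mk, z ∈ maximalIdeal S' := by
    intro z hz
    obtain ⟨x, hx, rfl⟩ := List.mem_map.mp hz
    rw [← hmaxq]
    exact Ideal.mem_map_of_mem mk (hys x hx)
  -- `S' ⧸ (ys) ≅ S ⧸ (gs ++ ys)`
  have e₂ : (S' ⧸ Ideal.ofList (ys.map mk)) ≃+* S ⧸ Ideal.ofList L :=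
    ((Ideal.quotEquivOfEq (Ideal.map_ofList mk ys).symm).trans
      (DoubleQuot.quotQuotEquivQuotSup (Ideal.ofList gs) (Ideal.ofList ys))).trans
      (Ideal.quotEquivOfEq (Ideal.ofList_append gs ys).symm)
  have hcl' := DegreeZeroDescent.inlineClause_of_ringEquiv p e₂.symm hcl
  exact iteratedDeformation p S' (ys.map mk) hmem₂ hw₂ hcl'

/-- **CI CHART CORE** (idea-1 `Sketch-L1-idea-1.lean` §8 `ciChartCore`, signature verbatim with the sketch's
`InlineClause` unfolded): `S` a regular local ring of characteristic `p`, presented by `N = dim S` generators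
`x` of its maximal ideal; `gs` the local equations and `ys` the orbit coordinates, all in `𝔪_S`, with
`dim S⧸(gs ++ ys) + |gs| + |ys| = N`. If the initial complete intersection `S ⧸ (gs ++ ys)` satisfies the
per-stalk clause of crux `FInjectiveMacaulayfication` (inline form), then so does the local ring `S ⧸ (gs)`
of the model. (The torus engine CN one embedding codimension up; `IsRegularLocalRing S` from
`spanFinrank 𝔪 ≤ N = dim S`, then `ciChartCore'`.) [folklore] -/
theorem ciChartCore : ∀ (p : ℕ) [Fact p.Prime] (S : Type) [CommRing S] [IsNoetherianRing S] [IsLocalRing S]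
    [CharP S p] (N : ℕ) (x : Fin N → S), Ideal.span (Set.range x) = IsLocalRing.maximalIdeal S →
    ringKrullDim S = N →
    ∀ (gs ys : List S), (∀ g ∈ gs, g ∈ IsLocalRing.maximalIdeal S) → (∀ y ∈ ys, y ∈ IsLocalRing.maximalIdeal S) →
    ringKrullDim (S ⧸ Ideal.ofList (gs ++ ys)) + ((gs.length + ys.length : ℕ) : WithBot ℕ∞) = (N : WithBot ℕ∞) →
    (∀ d : ℕ, ringKrullDim (S ⧸ Ideal.ofList (gs ++ ys)) = d →
      ∀ s : Fin d → S ⧸ Ideal.ofList (gs ++ ys), (Ideal.span (Set.range s)).radical.IsMaximal →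
      RingTheory.Sequence.IsWeaklyRegular (S ⧸ Ideal.ofList (gs ++ ys)) (List.ofFn s) ∧
      ∀ y : S ⧸ Ideal.ofList (gs ++ ys), (∃ e : ℕ, y ^ p ^ e ∈
        Ideal.span ((fun z : S ⧸ Ideal.ofList (gs ++ ys) => z ^ p ^ e) ''
          (Ideal.span (Set.range s) : Set (S ⧸ Ideal.ofList (gs ++ ys))))) → y ∈ Ideal.span (Set.range s)) →
    ∀ d : ℕ, ringKrullDim (S ⧸ Ideal.ofList gs) = d → ∀ s : Fin d → S ⧸ Ideal.ofList gs,
      (Ideal.span (Set.range s)).radical.IsMaximal →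
      RingTheory.Sequence.IsWeaklyRegular (S ⧸ Ideal.ofList gs) (List.ofFn s) ∧
      ∀ y : S ⧸ Ideal.ofList gs, (∃ e : ℕ, y ^ p ^ e ∈
        Ideal.span ((fun z : S ⧸ Ideal.ofList gs => z ^ p ^ e) ''
          (Ideal.span (Set.range s) : Set (S ⧸ Ideal.ofList gs)))) → y ∈ Ideal.span (Set.range s) := by
  intro p _ S _ _ _ _ N x hx hN gs ys hgs hys hdim hcl
  -- `S` is a regular local ring: `𝔪` is generated by `N = dim S` elements
  haveI : IsRegularLocalRing S := by
    refine IsRegularLocalRing.of_spanFinrank_maximalIdeal_le S ?_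
    rw [hN, ← hx]
    have h1 := Submodule.spanFinrank_span_le_ncard_of_finite (R := S) (M := S) (Set.finite_range x)
    have h2 : (Set.range x).ncard ≤ N := by
      have h := Set.ncard_image_le (f := x) (s := Set.univ) (Set.finite_univ)
      rwa [Set.image_univ, Set.ncard_univ, Nat.card_eq_fintype_card, Fintype.card_fin] at h
    exact_mod_cast h1.trans h2
  exact ciChartCore' p S gs ys hgs hys (by rw [hdim, hN]) hcl

/-- **Integrality half at a chart point** (idea-1 `Sketch-L1-idea-1.lean` §8 `isDomain_of_away`, verbatim):
if `y` is a non-zero-divisor of `B` and `B[1/y]` is a domain, then `B` is a domain (`B → B[1/y]` is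
injective). [folklore] -/
theorem isDomain_of_away : ∀ (B : Type) [CommRing B] (y : B), y ∈ nonZeroDivisors B →
    IsDomain (Localization.Away y) → IsDomain B := by
  intro B _ y hy hdom
  have hle : Submonoid.powers y ≤ nonZeroDivisors B := Submonoid.powers_le.mpr hy
  exact Function.Injective.isDomain (algebraMap B (Localization.Away y))
    (IsLocalization.injective (Localization.Away y) hle)

end Summit.ResolutionOfSingularities.ResolutionOfSingularities.Theorems.FInjectiveMacaulayfication.CIChartCore
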